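import Summits.BirchSwinnertonDyer.BirchSwinnertonDyer.Theorems.BiquadraticEisensteinDescentEisensteinHeartFlatCMInertBadKPrimeCMDatumAdapter
import Summits.BirchSwinnertonDyer.BirchSwinnertonDyer.Theorems.BiquadraticEisensteinDescentEisensteinHeartFlatCMInertBadKPrimeSqrtEndomorphismTwist
import Summits.BirchSwinnertonDyer.BirchSwinnertonDyer.Theorems.BiquadraticEisensteinDescentEisensteinHeartFlatCMInertBadKPrimeBiquadraticPrimes
import HarnessLib

set_option linter.dupNamespace false -- `Summit.BirchSwinnertonDyer.BirchSwinnertonDyer.Theorems.…` (summit = sub)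
set_option autoImplicit false

/-!
# Crux `EisensteinHeartFlatCMInertBadKPrime` (stmt-BirchSwinnertonDyer-21341), line `hsieh-lambda`, layer 2 — the CM DATUM DISCHARGED for the seven
# certified `j`-invariants: «CMInert + p split in K′ + V4 (∀ admissible data) ⟹ ♭-heart shape of Ch_Λ(X_ac)» with NO endomorphism hypothesis left

Route `BiquadraticEisensteinDescent` (cell `pub/bsd-wall`, width-prover seat `bsd-wall-cm-bed-w1` g5). Assembly of
`…CMDatumAdapter.heartShape_xac_of_sqrt_endomorphism` (V3 packaged + CM datum adapter), `…SqrtEndomorphismTwist.exists_sqrt_endomorphism_of_j_mem`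
(`[√d_K]` in Galois-action form from the tree's kernel-certified CM isogenies) and the instantiation lemmas of `…BiquadraticPrimes` (w2:
`not_isSquare_of_cmInert`, `not_exists_sq_eq_of_split`, `sqrt_not_mem_range`):

* `toZMod_ne_sq_of_not_isSquare` — `¬ IsSquare (d : ZMod p)` in the `PadicInt.toZMod` form used by `…UnramifiedQuadraticRing`;
* **`heartShape_xac_of_cmInert_of_j_mem`** — for `W/ℚ` with `W.j` one of the seven certified CM `j`-invariants (`d_K ∈ {-7, -11, -19, -43, -67, -163}`),
  `p ≠ 2` with `CMInert W p`, a quadratic field `K` in which `p` splits (`𝔭₁ ≠ 𝔭₂` above `p`), any `U ≤ Γ_K` presented as the stabiliser of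
  `√d_K = geomSqrt d_K ∈ K̄` (`U = Γ_{K·K_CM}`), ANY topological generator `γ`, `X_ac(W_K)` finitely generated torsion, and the ∀-admissible V4-shaped
  input `hV4` (NOT asserted): the ♭-heart shape `∃ m, p^m · Ch_Λ(X_ac) · 𝓞_{ℂ_p}⟦T⟧ ⊆ (Q)`.

What this file does NOT cover: `j = 0, 1728, 54000, -12288000, 287496, 8000` (no twist certificate / transport in the tree), V4 itself, and the passage
from the Katz/Hsieh frame to the BDP frame `Q` (V2). THEOREMS ONLY (no definition, no named fact, no instance, no `sorry`); nothing about V2/V4 or any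
case of BSD is asserted; BSD is not proved by any of this. Supports stmt-BirchSwinnertonDyer-21341 as a helper.

References: [PollackRubin2004] proof of Thm. 7.3; [Rubin1991] §4 p. 36; [SilvermanAdvancedTopics1994] II §2 Thm. 2.2(b), App. A §3; [CoxPrimes2013] Cor. 5.17.
-/

noncomputable section

open scoped Classical

universe u

namespace Summit.BirchSwinnertonDyer.BirchSwinnertonDyer.Theorems.BiquadraticEisensteinDescentEisensteinHeartFlatCMInertBadKPrimeCMLeaf

open NumberField IsDedekindDomain PowerSeries Field WeierstrassCurve
  Literature.NumberTheory.EllipticCurves Literature.NumberTheory.EllipticCurves.GreenbergSelmer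
  Literature.NumberTheory.EllipticCurves.Module
  Literature.NumberTheory.EllipticCurves.IwasawaDual Literature.NumberTheory.GaloisRepresentations
  Literature.NumberTheory.EllipticCurves.Rank1Residual
  Summit.BirchSwinnertonDyer.Rank1Residual.X11b Summit.BirchSwinnertonDyer.Rank1Residual.X11b.AcSelmer
  Summit.BirchSwinnertonDyer.BirchSwinnertonDyer.Theorems.BiquadraticEisensteinDescentDefs
  Summit.BirchSwinnertonDyer.BirchSwinnertonDyer.Theorems.BiquadraticEisensteinDescentEisensteinHeartFlatCMInertBadKPrimeSelmerTower
  Summit.BirchSwinnertonDyer.BirchSwinnertonDyer.Theorems.BiquadraticEisensteinDescentEisensteinHeartFlatCMInertBadKPrimeShapiroDatum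
  Summit.BirchSwinnertonDyer.BirchSwinnertonDyer.Theorems.BiquadraticEisensteinDescentEisensteinHeartFlatCMInertBadKPrimeCMDatumAdapter
  Summit.BirchSwinnertonDyer.BirchSwinnertonDyer.Theorems.BiquadraticEisensteinDescentEisensteinHeartFlatCMInertBadKPrimeSqrtEndomorphismTwist
  Summit.BirchSwinnertonDyer.BirchSwinnertonDyer.Theorems.BiquadraticEisensteinDescentEisensteinHeartFlatCMInertBadKPrimeBiquadraticPrimes

/-! ## §1 The non-square condition in `ℤ_p` form -/

/-- `¬ IsSquare (d : ZMod p)` in the form `∀ y, y * y ≠ PadicInt.toZMod d` used by `…UnramifiedQuadraticRing`. [folklore] -/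
theorem toZMod_ne_sq_of_not_isSquare {p : ℕ} [Fact p.Prime] {d : ℤ} (hd : ¬ IsSquare ((d : ℤ) : ZMod p)) (y : ZMod p) :
    y * y ≠ PadicInt.toZMod ((d : ℤ) : ℤ_[p]) := by
  intro hy
  rw [map_intCast] at hy
  exact hd ⟨y, hy.symm⟩

/-! ## §2 The ♭-heart shape with the CM datum discharged (seven certified `j`-invariants) -/

section Leaf

variable (W : WeierstrassCurve ℚ) [W.IsElliptic] {p : ℕ} [Fact p.Prime] {K : Type} [Field K] [NumberField K]
  (κ : ZpExtension K p) (𝔭 : HeightOneSpectrum (𝓞 K)) (S : Set (HeightOneSpectrum (𝓞 K)))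
  (U : Subgroup (absoluteGaloisGroup K)) [U.Normal]

/-- **♭-heart shape of `Ch_Λ(X_ac(W_K))` from `CMInert`, `p` split in `K`, and V4 — CM datum discharged.** For `W/ℚ` with `W.j` one of the seven
certified CM `j`-invariants, `p ≠ 2` inert in the CM field (`CMInert W p`), `K` quadratic with two distinct primes `𝔭₁ ≠ 𝔭₂` above `p`, `U ≤ Γ_K` with
`σ ∈ U ↔ σ (√d_K) = √d_K` (`√d_K := geomSqrt d_K ∈ K̄`), ANY topological generator `γ` of `κ`, `X_ac` finitely generated torsion, and `hV4` — the
V4-shaped divisibility for the upper module `N`, for EVERY admissible `(ψ, φ, γ′, f, h, δ, b, ι)` — one gets `∃ m, p^m·Ch_Λ(X_ac)·𝓞_{ℂ_p}⟦T⟧ ⊆ (Q)`.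
The CM endomorphism is no longer a hypothesis: `ψ = [√d_K]` comes from `…SqrtEndomorphismTwist.exists_sqrt_endomorphism_of_j_mem`, `√d_K ∉ K` from
`…BiquadraticPrimes.not_exists_sq_eq_of_split`, `d_K` non-square mod `p` from `…BiquadraticPrimes.not_isSquare_of_cmInert`. `hV4` is NOT asserted.
[cite: PollackRubin2004, proof of Thm. 7.3] [cite: SilvermanAdvancedTopics1994, II §2, Thm. II.2.2(b)] -/
theorem heartShape_xac_of_cmInert_of_j_mem
    (hj : W.j = -3375 ∨ W.j = 16581375 ∨ W.j = -32768 ∨ W.j = -884736 ∨ W.j = -884736000 ∨ W.j = -147197952000 ∨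
      W.j = -262537412640768000)
    (hp2 : p ≠ 2) (hinert : CMInert W p) (hK2 : Module.finrank ℚ K = 2)
    {𝔭₁ 𝔭₂ : HeightOneSpectrum (𝓞 K)} (h𝔭₁ : ((p : ℕ) : 𝓞 K) ∈ 𝔭₁.asIdeal) (h𝔭₂ : ((p : ℕ) : 𝓞 K) ∈ 𝔭₂.asIdeal) (hne : 𝔭₁ ≠ 𝔭₂)
    (hUr : ∀ σ : absoluteGaloisGroup K, σ ∈ U ↔ σ • geomSqrt ((cmFieldDiscrOfJ W.j : ℤ) : K) = geomSqrt ((cmFieldDiscrOfJ W.j : ℤ) : K))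
    (γ : absoluteGaloisGroup K) [Fact (κ.IsTopGenerator γ)]
    [Module.Finite (IwasawaAlgebra p) (XAc (W.baseChange K) p κ 𝔭 S γ)]
    (hM : Module.IsTorsion (IwasawaAlgebra p) (XAc (W.baseChange K) p κ 𝔭 S γ))
    {Q : PowerSeries 𝓞_ℂ_[p]}
    (hV4 : ∀ (ψ : (W.baseChange K).geomPoints →+ (W.baseChange K).geomPoints)
      (_ : ∀ σ : absoluteGaloisGroup K, σ • geomSqrt ((cmFieldDiscrOfJ W.j : ℤ) : K) = geomSqrt ((cmFieldDiscrOfJ W.j : ℤ) : K) →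
        ∀ P, σ • ψ P = ψ (σ • P))
      (_ : ∀ σ : absoluteGaloisGroup K, σ • geomSqrt ((cmFieldDiscrOfJ W.j : ℤ) : K) = -geomSqrt ((cmFieldDiscrOfJ W.j : ℤ) : K) →
        ∀ P, σ • ψ P = -ψ (σ • P))
      (_ : ∀ P, ψ (ψ P) = (cmFieldDiscrOfJ W.j) • P)
      (φ : (W.baseChange K).geomPrimaryTorsion p →+ (W.baseChange K).geomPrimaryTorsion p)
      (_ : ∀ m, ((φ m : (W.baseChange K).geomPrimaryTorsion p) : (W.baseChange K).geomPoints) = ψ m)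
      (hφH' : ∀ (x : (κ.kerSubgroup ⊓ U : Subgroup (absoluteGaloisGroup K))) (m : (W.baseChange K).geomPrimaryTorsion p), φ (x • m) = x • φ m)
      (hφU : ∀ σ ∈ U, ∀ m : (W.baseChange K).geomPrimaryTorsion p, φ (σ • m) = σ • φ m)
      (hφU' : ∀ σ, σ ∉ U → ∀ m : (W.baseChange K).geomPrimaryTorsion p, φ (σ • m) = -(σ • φ m))
      (hφ2 : ∀ m, φ (φ m) = (cmFieldDiscrOfJ W.j) • m)
      (γ' : absoluteGaloisGroup K) (_ : κ.IsTopGenerator γ') (_ : γ' ∈ U)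
      (f : AddMonoid.End (selmerOver (κ.kerSubgroup ⊓ U) ((W.baseChange K).geomPrimaryTorsion p) p 𝔭 S))
      (_hf : ∀ s, ((f s : selmerOver (κ.kerSubgroup ⊓ U) ((W.baseChange K).geomPrimaryTorsion p) p 𝔭 S) :
        subgroupH1 (κ.kerSubgroup ⊓ U) ((W.baseChange K).geomPrimaryTorsion p)) =
          conjH1 (κ.kerSubgroup ⊓ U) ((W.baseChange K).geomPrimaryTorsion p) γ' s)
      (h : IsLocNil p (f - 1))
      (δ : LocNilDual (selmerOver (κ.kerSubgroup ⊓ U) ((W.baseChange K).geomPrimaryTorsion p) p 𝔭 S) f h →ₗ[IwasawaAlgebra p]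
        LocNilDual (selmerOver (κ.kerSubgroup ⊓ U) ((W.baseChange K).geomPrimaryTorsion p) p 𝔭 S) f h)
      (hδ : ∀ (x : LocNilDual (selmerOver (κ.kerSubgroup ⊓ U) ((W.baseChange K).geomPrimaryTorsion p) p 𝔭 S) f h)
        (s t : selmerOver (κ.kerSubgroup ⊓ U) ((W.baseChange K).geomPrimaryTorsion p) p 𝔭 S),
        (t : subgroupH1 (κ.kerSubgroup ⊓ U) ((W.baseChange K).geomPrimaryTorsion p)) =
          resH1Hom (ContinuousMonoidHom.id _) φ hφH' (s : subgroupH1 (κ.kerSubgroup ⊓ U) ((W.baseChange K).geomPrimaryTorsion p)) →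
          δ x s = x t)
      (b : Module.Basis (Fin 2) ℤ_[p] (AdjoinRoot (Polynomial.X ^ 2 - Polynomial.C ((cmFieldDiscrOfJ W.j : ℤ) : ℤ_[p]) : Polynomial ℤ_[p])))
      (hb0 : b 0 = 1)
      (hb1 : b 1 * b 1 = algebraMap ℤ_[p] (AdjoinRoot (Polynomial.X ^ 2 - Polynomial.C ((cmFieldDiscrOfJ W.j : ℤ) : ℤ_[p]) : Polynomial ℤ_[p]))
        ((cmFieldDiscrOfJ W.j : ℤ) : ℤ_[p]))
      (ι : AdjoinRoot (Polynomial.X ^ 2 - Polynomial.C ((cmFieldDiscrOfJ W.j : ℤ) : ℤ_[p]) : Polynomial ℤ_[p]) →+* 𝓞_ℂ_[p])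
      (_ : ι.comp (algebraMap ℤ_[p] _) = R1.toCpInt p),
      ∃ m : ℕ, ∀ x ∈ (charIdeal (PowerSeries (AdjoinRoot (Polynomial.X ^ 2 - Polynomial.C ((cmFieldDiscrOfJ W.j : ℤ) : ℤ_[p]) : Polynomial ℤ_[p])))
          (WithQuadratic (LocNilDual (selmerOver (κ.kerSubgroup ⊓ U) ((W.baseChange K).geomPrimaryTorsion p) p 𝔭 S) f h) b hb0 hb1 δ
            (delta_sq (W.baseChange K) κ 𝔭 S U φ hφH' hφU hφU' (cmFieldDiscrOfJ W.j) hφ2 f h δ hδ))).map (PowerSeries.map ι),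
        (PowerSeries.C ((p : ℕ) : 𝓞_ℂ_[p]) : PowerSeries 𝓞_ℂ_[p]) ^ m * x ∈ Ideal.span {Q}) :
    ∃ m : ℕ, ∀ x ∈ (XAc.charIdeal (W.baseChange K) p κ 𝔭 S γ).map (PowerSeries.map (R1.toCpInt p)),
      (PowerSeries.C ((p : ℕ) : 𝓞_ℂ_[p]) : PowerSeries 𝓞_ℂ_[p]) ^ m * x ∈ Ideal.span {Q} := by
  set d₀ : ℤ := cmFieldDiscrOfJ W.j with hd₀
  set r : AlgebraicClosure K := geomSqrt ((d₀ : ℤ) : K) with hrdef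
  -- `d_K` is a non-square mod `p`
  have hd' : ¬ IsSquare ((d₀ : ℤ) : ZMod p) := not_isSquare_of_cmInert hp2 hinert
  have hd : ∀ y : ZMod p, y * y ≠ PadicInt.toZMod ((d₀ : ℤ) : ℤ_[p]) := toZMod_ne_sq_of_not_isSquare hd'
  -- `r = √d_K ∈ K̄ ∖ K`
  have hr2 : r ^ 2 = algebraMap K (AlgebraicClosure K) ((d₀ : ℤ) : K) := geomSqrt_sq _
  have hr : r * r = algebraMap K (AlgebraicClosure K) ((d₀ : ℤ) : K) := by rw [← sq]; exact hr2
  have hKsq : ¬ ∃ y : K, y ^ 2 = ((d₀ : ℤ) : K) := not_exists_sq_eq_of_split hK2 hd' h𝔭₁ h𝔭₂ hne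
  have hrK : r ∉ Set.range (algebraMap K (AlgebraicClosure K)) :=
    sqrt_not_mem_range hKsq (x := r) (by rw [hr2, map_intCast])
  have hr0 : r ≠ 0 := ne_zero_of_not_mem_range hrK
  obtain ⟨σ₀, hσ₀⟩ := exists_smul_eq_neg r ((d₀ : ℤ) : K) hr hrK
  -- the CM endomorphism in Galois-action form
  obtain ⟨ψ, hψU, hψU', hψ2⟩ := exists_sqrt_endomorphism_of_j_mem W hj r hr2 hr0 σ₀ hσ₀
  exact heartShape_xac_of_sqrt_endomorphism (W.baseChange K) κ 𝔭 S U hp2 γ ψ d₀ r hr hrK hUr hψU hψU' hψ2 hd hM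
    (hV4 ψ hψU hψU' hψ2)

end Leaf

end Summit.BirchSwinnertonDyer.BirchSwinnertonDyer.Theorems.BiquadraticEisensteinDescentEisensteinHeartFlatCMInertBadKPrimeCMLeaf

end
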